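import Summits.FinalStateConjecture.FinalStateConjecture.Theorems.EIHFluxBalanceInertialRecessionChargeKinematicsFlyBy
import Summits.FinalStateConjecture.FinalStateConjecture.Theorems.EIHFluxBalanceInertialRecessionChargeKinematicsSingleton
import Mathlib.MeasureTheory.Integral.IntervalIntegral.FundThmCalculus

/-!
# Route EIHFluxBalance — `InertialRecession`, line `old-light-leaves-the-cone`: charge kinematics,
# V (passages: pair radius, first exit, passage budget)

Helper file for the crux `stmt-FinalStateConjecture-10166`
(`Summit.FinalStateConjecture.FinalStateConjecture.Theses.EIHFluxBalance.InertialRecession`), second line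
lead, endgame stub `stub_expandingChargeKinematics` (S4: abstract quasi-conserved window charges with the
slack-form window law and the single-hole identification ⇒ Cesàro velocities of the painted centres).

V — PASSAGES: the pair radius `min(‖ξᵢ − ξⱼ‖/3, c₂ s)` of an isolated pair (`pair_radius`), first-exit
bookkeeping for continuous paths (`exists_first_exit`), the velocity increment from the singleton
bookkeeping (`velocity_increment_le`), and the GEOMETRIC BUDGET OF A PASSAGE (`passage_budget_le`): while a
coordinate `φ = ⟪e, ξᵢ − ξⱼ⟫` moves monotonically at rate `≥ g`, `∫(R⁻² + R^{-7/4})` along the pair radius is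
bounded by two fly-by integrals (`ChargeKinematicsFlyBy`) and two tails, uniformly in the length of the passage.

Every statement is Mathlib-only real analysis over the stub's verbatim hypotheses ([folklore]); the abstract
charge `P` is arbitrary (adversarial), constrained only by the window law and the identification.
-/

set_option linter.dupNamespace false

noncomputable section

open Filter Set Metric Real
open scoped Topology

namespace Summit.FinalStateConjecture.FinalStateConjecture.Theorems.ChargeKinematics

open Literature.Geometry.Lorentzian

/-! ## The pair radius and the freezing of old relative velocity -/

section PairDynamics

open MeasureTheory intervalIntegral

variable {N : ℕ} {M : Fin N → ℝ} {ξ v : Fin N → ℝ → E3} {κ : ℝ} {P : ℝ → E3 → ℝ → Fin 4 → ℝ}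

/-- **The pair radius.** For two holes `i ≠ j` whose other partners recede linearly (`≥ μ₀ t`), the
radius `R(s) = min(‖ξᵢ − ξⱼ‖/3, c₂ s)` with `0 < c₂ ≤ min((κ−κ²)/2, μ₀/3, 1)` is eventually `2`-Lipschitz,
below the cone rate, keeps every other centre `≥ 3R` away from BOTH `ξᵢ` and `ξⱼ`, and tends to `+∞`
(the holes separate). It is the radius at which the singleton law is read for both members of the pair.
[folklore] -/
theorem pair_radius (hξ : ∀ i, ContDiff ℝ ((⊤ : ℕ∞) : WithTop ℕ∞) (ξ i))
    (hsep : ∀ i j, i ≠ j → Tendsto (fun t ↦ ‖ξ i t - ξ j t‖) atTop atTop)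
    (hk : ∃ k : ℝ, 0 ≤ k ∧ k < 1 ∧ ∀ i, ∀ᶠ t in atTop, ‖v i t‖ ≤ k)
    (hslave : ∀ i, Tendsto (fun t ↦ deriv (ξ i) t - v i t) atTop (𝓝 0))
    {i j : Fin N} (hij : i ≠ j) {μ₀ c₂ : ℝ} (hc₂ : 0 < c₂) (hc₂κ : c₂ ≤ (κ - κ ^ 2) / 2)
    (hc₂μ : c₂ ≤ μ₀ / 3) (hc₂1 : c₂ ≤ 1)
    (hiso : ∀ k, k ≠ i → k ≠ j → ∀ᶠ t in atTop, μ₀ * t ≤ ‖ξ i t - ξ k t‖ ∧ μ₀ * t ≤ ‖ξ j t - ξ k t‖) :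
    ∃ TR : ℝ,
      (∀ s s', TR ≤ s → TR ≤ s' → |min (‖ξ i s - ξ j s‖ / 3) (c₂ * s) -
        min (‖ξ i s' - ξ j s'‖ / 3) (c₂ * s')| ≤ 2 * |s - s'|) ∧
      (∀ s, TR ≤ s → min (‖ξ i s - ξ j s‖ / 3) (c₂ * s) ≤ (κ - κ ^ 2) / 2 * s) ∧
      (∀ s, TR ≤ s → ∀ k, k ≠ i → 3 * min (‖ξ i s - ξ j s‖ / 3) (c₂ * s) ≤ ‖ξ i s - ξ k s‖) ∧
      (∀ s, TR ≤ s → ∀ k, k ≠ j → 3 * min (‖ξ i s - ξ j s‖ / 3) (c₂ * s) ≤ ‖ξ j s - ξ k s‖) ∧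
      Tendsto (fun s ↦ min (‖ξ i s - ξ j s‖ / 3) (c₂ * s)) atTop atTop := by
  obtain ⟨k, hk0, hk1, hvk⟩ := hk
  have hdi : Differentiable ℝ (ξ i) := (contDiff_infty_iff_deriv.mp (hξ i)).1
  have hdj : Differentiable ℝ (ξ j) := (contDiff_infty_iff_deriv.mp (hξ j)).1
  obtain ⟨Ti, hTi⟩ := exists_forall_norm_sub_le_two_mul hdi (hslave i) hk1.le (hvk i)
  obtain ⟨Tj, hTj⟩ := exists_forall_norm_sub_le_two_mul hdj (hslave j) hk1.le (hvk j)
  -- the isolation clause for all other bodies at once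
  have hiso' : ∀ᶠ t in atTop, ∀ k, k ≠ i → k ≠ j →
      μ₀ * t ≤ ‖ξ i t - ξ k t‖ ∧ μ₀ * t ≤ ‖ξ j t - ξ k t‖ := by
    have : ∀ k, ∀ᶠ t in atTop, k ≠ i → k ≠ j →
        μ₀ * t ≤ ‖ξ i t - ξ k t‖ ∧ μ₀ * t ≤ ‖ξ j t - ξ k t‖ := fun k ↦ by
      by_cases hki : k = i
      · exact Eventually.of_forall fun t h _ ↦ (h hki).elim
      by_cases hkj : k = j
      · exact Eventually.of_forall fun t _ h ↦ (h hkj).elim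
      exact (hiso k hki hkj).mono fun t ht _ _ ↦ ht
    exact eventually_all.mpr this
  obtain ⟨TR, hTR⟩ := eventually_atTop.mp (hiso'.and ((eventually_ge_atTop Ti).and
    ((eventually_ge_atTop Tj).and (eventually_ge_atTop (0 : ℝ)))))
  refine ⟨TR, fun s s' hs hs' ↦ ?_, fun s hs ↦ ?_, fun s hs k' hk' ↦ ?_, fun s hs k' hk' ↦ ?_, ?_⟩
  · -- `2`-Lipschitz
    obtain ⟨-, hTis, hTjs, -⟩ := hTR s hs
    obtain ⟨-, hTis', hTjs', -⟩ := hTR s' hs'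
    refine (abs_min_sub_min_le_max _ _ _ _).trans (max_le ?_ ?_)
    · have h1 := hTi s s' hTis hTis'
      have h2 := hTj s s' hTjs hTjs'
      have h3 : |‖ξ i s - ξ j s‖ - ‖ξ i s' - ξ j s'‖| ≤ ‖(ξ i s - ξ j s) - (ξ i s' - ξ j s')‖ :=
        abs_norm_sub_norm_le _ _
      have h4 : ‖(ξ i s - ξ j s) - (ξ i s' - ξ j s')‖ ≤ ‖ξ i s - ξ i s'‖ + ‖ξ j s - ξ j s'‖ := by
        have : (ξ i s - ξ j s) - (ξ i s' - ξ j s') = (ξ i s - ξ i s') - (ξ j s - ξ j s') := by abel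
        rw [this]
        exact norm_sub_le _ _
      rw [← sub_div, abs_div, abs_of_pos (by norm_num : (0 : ℝ) < 3)]
      rw [div_le_iff₀ (by norm_num : (0 : ℝ) < 3)]
      have : 0 ≤ |s - s'| := abs_nonneg _
      linarith
    · rw [← mul_sub, abs_mul, abs_of_pos hc₂]
      exact mul_le_mul_of_nonneg_right (hc₂1.trans (by norm_num)) (abs_nonneg _)
  · obtain ⟨-, -, -, hs0⟩ := hTR s hs
    exact (min_le_right _ _).trans (mul_le_mul_of_nonneg_right hc₂κ hs0)
  · obtain ⟨hisos, -, -, hs0⟩ := hTR s hs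
    by_cases hk'j : k' = j
    · subst hk'j
      have := min_le_left (‖ξ i s - ξ k' s‖ / 3) (c₂ * s)
      linarith
    · have h := (hisos k' hk' hk'j).1
      have := min_le_right (‖ξ i s - ξ j s‖ / 3) (c₂ * s)
      nlinarith
  · obtain ⟨hisos, -, -, hs0⟩ := hTR s hs
    by_cases hk'i : k' = i
    · subst hk'i
      have := min_le_left (‖ξ k' s - ξ j s‖ / 3) (c₂ * s)
      rw [norm_sub_rev (ξ j s)]
      linarith
    · have h := (hisos k' hk'i hk').2
      have := min_le_right (‖ξ i s - ξ j s‖ / 3) (c₂ * s)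
      nlinarith
  · -- `R → ∞`
    have h1 : Tendsto (fun s ↦ ‖ξ i s - ξ j s‖ / 3) atTop atTop :=
      (hsep i j hij).atTop_div_const (by norm_num)
    have h2 : Tendsto (fun s : ℝ ↦ c₂ * s) atTop atTop := tendsto_id.const_mul_atTop hc₂
    rw [Filter.tendsto_atTop]
    intro b
    filter_upwards [h1.eventually_ge_atTop b, h2.eventually_ge_atTop b] with s hs1 hs2
    exact le_min hs1 hs2

/-- First-exit bookkeeping for a continuous path: if `f` is continuous on `[t₀, ∞)`, `f t₀ < a` and
`a ≤ f s₁` for some `s₁ ≥ t₀`, then there is a FIRST time `τ > t₀` with `f τ = a` and `f < a` on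
`[t₀, τ)`; in particular `f ≤ a` on `[t₀, τ]`. [folklore] -/
theorem exists_first_exit {f : ℝ → ℝ} {t₀ s₁ a : ℝ} (hf : Continuous f) (h0 : f t₀ < a)
    (hs₁ : t₀ ≤ s₁) (ha : a ≤ f s₁) :
    ∃ τ, t₀ < τ ∧ τ ≤ s₁ ∧ f τ = a ∧ ∀ s ∈ Set.Icc t₀ τ, f s ≤ a := by
  set S : Set ℝ := {s | t₀ ≤ s ∧ a ≤ f s} with hS
  have hne : S.Nonempty := ⟨s₁, hs₁, ha⟩
  have hbdd : BddBelow S := ⟨t₀, fun s hs ↦ hs.1⟩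
  have hclosed : IsClosed S :=
    (isClosed_le continuous_const continuous_id).inter (isClosed_le continuous_const hf)
  set τ := sInf S with hτ
  have hτS : τ ∈ S := hclosed.csInf_mem hne hbdd
  have hτs₁ : τ ≤ s₁ := csInf_le hbdd ⟨hs₁, ha⟩
  have ht₀τ : t₀ ≤ τ := hτS.1
  -- below `τ` the path is `< a`
  have hlt : ∀ s, t₀ ≤ s → s < τ → f s < a := by
    intro s hs hsτ
    by_contra h
    push Not at h
    exact absurd (csInf_le hbdd ⟨hs, h⟩) (not_le.mpr hsτ)
  have hne' : t₀ ≠ τ := fun h ↦ by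
    rw [← h] at hτS
    exact absurd hτS.2 (not_le.mpr h0)
  have ht₀τ' : t₀ < τ := lt_of_le_of_ne ht₀τ hne'
  -- at `τ` the value is exactly `a`: `≥` by membership, `≤` by the left limit
  have hle : f τ ≤ a := by
    have htend : Tendsto f (𝓝[<] τ) (𝓝 (f τ)) := (hf.tendsto τ).mono_left nhdsWithin_le_nhds
    have hev : ∀ᶠ s in 𝓝[<] τ, f s ≤ a := by
      have : ∀ᶠ s in 𝓝[<] τ, t₀ < s :=
        Filter.eventually_of_mem (Ioo_mem_nhdsLT ht₀τ') fun s hs ↦ hs.1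
      filter_upwards [this, self_mem_nhdsWithin] with s hs hsτ
      exact (hlt s hs.le hsτ).le
    exact le_of_tendsto htend hev
  refine ⟨τ, ht₀τ', hτs₁, le_antisymm hle hτS.2, fun s hs ↦ ?_⟩
  rcases eq_or_lt_of_le hs.2 with h | h
  · rw [h]; exact hle
  · exact (hlt s hs.1 h).le

end PairDynamics

/-! ## Velocity increments and the geometric budget along a passage -/

section Increments

open MeasureTheory intervalIntegral

/-- **Velocity increment from the singleton bookkeeping.** If at two times `t₀, τ` the four charge
components are `e`-close to `M(γ, γv)` and each component moved by at most `L`, then (with `γ(τ) ≥ 1`,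
`‖v(t₀)‖ ≤ 1`, `M > 0`) the velocity moved by at most `4(L + e(t₀) + e(τ))/M`. [folklore] -/
theorem velocity_increment_le {M : ℝ} {vτ v₀ : E3} {Pτ P₀ : Fin 4 → ℝ} {L eτ e₀ : ℝ} (hM : 0 < M)
    (hγτ : ‖vτ‖ < 1) (hv₀ : ‖v₀‖ ≤ 1)
    (hidτ : |Pτ 0 - M * (√(1 - ‖vτ‖ ^ 2))⁻¹| ≤ eτ ∧
      ∀ k : Fin 3, |Pτ k.succ - M * (√(1 - ‖vτ‖ ^ 2))⁻¹ * vτ k| ≤ eτ)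
    (hid₀ : |P₀ 0 - M * (√(1 - ‖v₀‖ ^ 2))⁻¹| ≤ e₀ ∧
      ∀ k : Fin 3, |P₀ k.succ - M * (√(1 - ‖v₀‖ ^ 2))⁻¹ * v₀ k| ≤ e₀)
    (hlaw : ∀ μ : Fin 4, |Pτ μ - P₀ μ| ≤ L) :
    ‖vτ - v₀‖ ≤ 4 * (L + e₀ + eτ) / M := by
  set γτ : ℝ := (√(1 - ‖vτ‖ ^ 2))⁻¹ with hγτdef
  set γ₀ : ℝ := (√(1 - ‖v₀‖ ^ 2))⁻¹ with hγ₀def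
  have hγτ1 : 1 ≤ γτ := one_le_gammaFactor hγτ
  -- the kinematic components moved by at most `I := L + e₀ + eτ` (divided by `M`)
  have h0 : |M * γτ - M * γ₀| ≤ L + e₀ + eτ := by
    have h1 := hidτ.1
    have h2 := hid₀.1
    have h3 := hlaw 0
    rw [abs_le] at h1 h2 h3 ⊢
    constructor <;> linarith
  have hk : ∀ k : Fin 3, |M * γτ * vτ k - M * γ₀ * v₀ k| ≤ L + e₀ + eτ := by
    intro k
    have h1 := hidτ.2 k
    have h2 := hid₀.2 k
    have h3 := hlaw k.succ
    rw [abs_le] at h1 h2 h3 ⊢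
    constructor <;> linarith
  -- hence `|γτ - γ₀| ≤ I/M` and `‖γτ vτ - γ₀ v₀‖ ≤ 3 I/M`
  have hγ : |γτ - γ₀| ≤ (L + e₀ + eτ) / M := by
    rw [le_div_iff₀ hM, ← abs_of_pos hM, ← abs_mul]
    have : (γτ - γ₀) * M = M * γτ - M * γ₀ := by ring
    rw [this]
    exact h0
  have hp : ‖γτ • vτ - γ₀ • v₀‖ ≤ 3 * ((L + e₀ + eτ) / M) := by
    refine (norm_le_sum_abs_coord _).trans ?_
    have hcoord : ∀ k : Fin 3, |(γτ • vτ - γ₀ • v₀) k| ≤ (L + e₀ + eτ) / M := by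
      intro k
      have hk' := hk k
      rw [le_div_iff₀ hM, ← abs_of_pos hM, ← abs_mul]
      have : (γτ • vτ - γ₀ • v₀) k * M = M * γτ * vτ k - M * γ₀ * v₀ k := by
        simp only [PiLp.sub_apply, PiLp.smul_apply, smul_eq_mul]
        ring
      rw [this]
      exact hk'
    calc ∑ k, |(γτ • vτ - γ₀ • v₀) k| ≤ ∑ _k : Fin 3, (L + e₀ + eτ) / M :=
          Finset.sum_le_sum fun k _ ↦ hcoord k
      _ = 3 * ((L + e₀ + eτ) / M) := by simp [Finset.sum_const, nsmul_eq_mul]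
  calc ‖vτ - v₀‖ ≤ ‖γτ • vτ - γ₀ • v₀‖ + |γτ - γ₀| := norm_sub_le_of_gamma hγτ1 hv₀
    _ ≤ 3 * ((L + e₀ + eτ) / M) + (L + e₀ + eτ) / M := add_le_add hp hγ
    _ = 4 * (L + e₀ + eτ) / M := by ring

/-- `((A/c)^p)⁻¹ = c^p · A^{-p}` for positive `A, c`. [folklore] -/
theorem inv_div_rpow {A c p : ℝ} (hA : 0 < A) (hc : 0 < c) :
    ((A / c) ^ p)⁻¹ = c ^ p * A ^ (-p) := by
  rw [Real.div_rpow hA.le hc.le, inv_div, Real.rpow_neg hA.le, div_eq_mul_inv]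

/-- **The geometric budget of a passage.** On an interval where the pair radius satisfies
`R(s) ≥ min(max(m₀, |φ s|)/3, c₂ s)`, `R ≥ 1`, and the coordinate `φ` moves monotonically at rate
`φ' ≥ g > 0` (with `φ` `C¹`), the window budget is bounded by two fly-by integrals and two tails:
`∫_{t₀}^{τ} (R⁻² + R^{-7/4}) ≤ 9·(4 m₀⁻¹/g) + 3^{7/4}·((14/3) m₀^{-3/4}/g) + (c₂² t₀)⁻¹ + (4/3)c₂^{-7/4}t₀^{-3/4}`,
uniformly in `τ`. [folklore] -/
theorem passage_budget_le {R φ φ' : ℝ → ℝ} {t₀ τ m₀ c₂ g : ℝ} (ht₀ : 0 < t₀) (hτ : t₀ ≤ τ)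
    (hm₀ : 0 < m₀) (hc₂ : 0 < c₂) (hg : 0 < g)
    (hRcont : ContinuousOn R (Set.Icc t₀ τ))
    (hR1 : ∀ s ∈ Set.Icc t₀ τ, 1 ≤ R s)
    (hRge : ∀ s ∈ Set.Icc t₀ τ, min (max m₀ |φ s| / 3) (c₂ * s) ≤ R s)
    (hφ : ∀ s, HasDerivAt φ (φ' s) s) (hφ' : Continuous φ')
    (hmono : ∀ s ∈ Set.Icc t₀ τ, g ≤ φ' s) :
    ∫ s in t₀..τ, (((R s) ^ 2)⁻¹ + ((R s) ^ (7 / 4 : ℝ))⁻¹) ≤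
      9 * (2 * 2 * m₀ ^ (1 - 2 : ℝ) / ((2 - 1) * g)) +
        (3 : ℝ) ^ (7 / 4 : ℝ) * (2 * (7 / 4) * m₀ ^ (1 - 7 / 4 : ℝ) / ((7 / 4 - 1) * g)) +
        ((c₂ ^ 2 * t₀)⁻¹ + 4 / 3 * c₂ ^ (-(7 / 4) : ℝ) * t₀ ^ (-(3 / 4) : ℝ)) := by
  -- the four dominating integrands
  set K₂ : ℝ → ℝ := fun s ↦ (max m₀ |φ s|) ^ (-(2 : ℝ)) with hK₂
  set K₇ : ℝ → ℝ := fun s ↦ (max m₀ |φ s|) ^ (-(7 / 4 : ℝ)) with hK₇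
  have hφc : Continuous φ := continuous_iff_continuousAt.mpr fun s ↦ (hφ s).continuousAt
  have hK₂c : Continuous K₂ := (continuous_flyByKernel m₀ 2 hm₀).comp hφc
  have hK₇c : Continuous K₇ := (continuous_flyByKernel m₀ (7 / 4) hm₀).comp hφc
  have hApos : ∀ s, 0 < max m₀ |φ s| := fun s ↦ hm₀.trans_le (le_max_left _ _)
  -- pointwise domination on `[t₀, τ]`
  have hpt : ∀ s ∈ Set.Icc t₀ τ, ((R s) ^ 2)⁻¹ + ((R s) ^ (7 / 4 : ℝ))⁻¹ ≤
      (9 * K₂ s + ((c₂ * s) ^ 2)⁻¹) + ((3 : ℝ) ^ (7 / 4 : ℝ) * K₇ s + ((c₂ * s) ^ (7 / 4 : ℝ))⁻¹) := by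
    intro s hs
    have hs0 : 0 < s := ht₀.trans_le hs.1
    have hcs : 0 < c₂ * s := mul_pos hc₂ hs0
    have hA3 : 0 < max m₀ |φ s| / 3 := by have := hApos s; positivity
    have hmin : 0 < min (max m₀ |φ s| / 3) (c₂ * s) := lt_min hA3 hcs
    have hRs : 0 < R s := one_pos.trans_le (hR1 s hs)
    refine add_le_add ?_ ?_
    · -- squares
      calc ((R s) ^ 2)⁻¹ ≤ ((min (max m₀ |φ s| / 3) (c₂ * s)) ^ 2)⁻¹ := by
            apply inv_anti₀ (pow_pos hmin 2)
            exact pow_le_pow_left₀ hmin.le (hRge s hs) 2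
        _ ≤ ((max m₀ |φ s| / 3) ^ 2)⁻¹ + ((c₂ * s) ^ 2)⁻¹ := inv_min_sq_le hA3 hcs
        _ = 9 * K₂ s + ((c₂ * s) ^ 2)⁻¹ := by
            congr 1
            have h9 : ((max m₀ |φ s| / 3) ^ 2)⁻¹ = 9 * ((max m₀ |φ s|) ^ 2)⁻¹ := by
              field_simp
              ring
            rw [h9, hK₂]
            simp only
            rw [Real.rpow_neg (hApos s).le, Real.rpow_two]
    · -- `7/4` powers
      calc ((R s) ^ (7 / 4 : ℝ))⁻¹ ≤ ((min (max m₀ |φ s| / 3) (c₂ * s)) ^ (7 / 4 : ℝ))⁻¹ :=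
            inv_rpow_le_inv_rpow hmin (hRge s hs) (by norm_num)
        _ ≤ ((max m₀ |φ s| / 3) ^ (7 / 4 : ℝ))⁻¹ + ((c₂ * s) ^ (7 / 4 : ℝ))⁻¹ :=
            inv_min_rpow_le _ hA3 hcs
        _ = (3 : ℝ) ^ (7 / 4 : ℝ) * K₇ s + ((c₂ * s) ^ (7 / 4 : ℝ))⁻¹ := by
            rw [inv_div_rpow (hApos s) (by norm_num : (0 : ℝ) < 3)]
  -- integrability of everything on `[t₀, τ]`
  have hpos : ∀ s ∈ Set.uIcc t₀ τ, 0 < c₂ * s := fun s hs ↦ by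
    rw [Set.uIcc_of_le hτ] at hs
    exact mul_pos hc₂ (ht₀.trans_le hs.1)
  have hcs : ContinuousOn (fun s : ℝ ↦ c₂ * s) (Set.uIcc t₀ τ) :=
    (continuous_const.mul continuous_id).continuousOn
  have hI1 : IntervalIntegrable (fun s ↦ ((R s) ^ 2)⁻¹ + ((R s) ^ (7 / 4 : ℝ))⁻¹) volume t₀ τ := by
    have hRc : ContinuousOn R (Set.uIcc t₀ τ) := by rwa [Set.uIcc_of_le hτ]
    have hRne : ∀ s ∈ Set.uIcc t₀ τ, R s ≠ 0 := fun s hs ↦ by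
      rw [Set.uIcc_of_le hτ] at hs
      exact (one_pos.trans_le (hR1 s hs)).ne'
    refine ContinuousOn.intervalIntegrable (ContinuousOn.add ?_ ?_)
    · exact (hRc.pow 2).inv₀ fun s hs ↦ pow_ne_zero 2 (hRne s hs)
    · refine (hRc.rpow_const fun s hs ↦ Or.inr (by norm_num)).inv₀ fun s hs ↦ ?_
      rw [Set.uIcc_of_le hτ] at hs
      exact (Real.rpow_pos_of_pos (one_pos.trans_le (hR1 s hs)) _).ne'
  have hI2 : IntervalIntegrable (fun s ↦ (9 * K₂ s + ((c₂ * s) ^ 2)⁻¹) +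
      ((3 : ℝ) ^ (7 / 4 : ℝ) * K₇ s + ((c₂ * s) ^ (7 / 4 : ℝ))⁻¹)) volume t₀ τ := by
    refine ((?_ : IntervalIntegrable _ volume t₀ τ).add ?_).add ((?_ : IntervalIntegrable _ volume t₀ τ).add ?_)
    · exact (hK₂c.intervalIntegrable _ _).const_mul 9
    · exact ContinuousOn.intervalIntegrable ((hcs.pow 2).inv₀ fun s hs ↦ (pow_pos (hpos s hs) 2).ne')
    · exact (hK₇c.intervalIntegrable _ _).const_mul _
    · refine ContinuousOn.intervalIntegrable ?_
      exact (hcs.rpow_const fun s hs ↦ Or.inr (by norm_num)).inv₀ fun s hs ↦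
        (Real.rpow_pos_of_pos (hpos s hs) _).ne'
  -- integrate the domination and split
  have hstep := intervalIntegral.integral_mono_on hτ hI1 hI2 hpt
  refine hstep.trans ?_
  have hK₂i : IntervalIntegrable (fun s ↦ 9 * K₂ s) volume t₀ τ := (hK₂c.intervalIntegrable _ _).const_mul 9
  have hc2i : IntervalIntegrable (fun s ↦ ((c₂ * s) ^ 2)⁻¹) volume t₀ τ :=
    ContinuousOn.intervalIntegrable ((hcs.pow 2).inv₀ fun s hs ↦ (pow_pos (hpos s hs) 2).ne')
  have hK₇i : IntervalIntegrable (fun s ↦ (3 : ℝ) ^ (7 / 4 : ℝ) * K₇ s) volume t₀ τ :=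
    (hK₇c.intervalIntegrable _ _).const_mul _
  have hc7i : IntervalIntegrable (fun s ↦ ((c₂ * s) ^ (7 / 4 : ℝ))⁻¹) volume t₀ τ := by
    refine ContinuousOn.intervalIntegrable ?_
    exact (hcs.rpow_const fun s hs ↦ Or.inr (by norm_num)).inv₀ fun s hs ↦
      (Real.rpow_pos_of_pos (hpos s hs) _).ne'
  rw [intervalIntegral.integral_add (hK₂i.add hc2i) (hK₇i.add hc7i),
    intervalIntegral.integral_add hK₂i hc2i, intervalIntegral.integral_add hK₇i hc7i,
    intervalIntegral.integral_const_mul, intervalIntegral.integral_const_mul]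
  -- the four bounds
  have hF₂ : ∫ s in t₀..τ, K₂ s ≤ 2 * 2 * m₀ ^ (1 - 2 : ℝ) / ((2 - 1) * g) :=
    flyBy_integral_le hτ hg hm₀ (by norm_num) hφ hφ' hmono
  have hF₇ : ∫ s in t₀..τ, K₇ s ≤ 2 * (7 / 4) * m₀ ^ (1 - 7 / 4 : ℝ) / ((7 / 4 - 1) * g) :=
    flyBy_integral_le hτ hg hm₀ (by norm_num) hφ hφ' hmono
  have hT₂ := integral_inv_sq_mul_le hc₂ ht₀ hτ
  have hT₇ := integral_inv_rpow_mul_le hc₂ ht₀ hτ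
  have h3 : 0 ≤ (3 : ℝ) ^ (7 / 4 : ℝ) := Real.rpow_nonneg (by norm_num) _
  nlinarith [mul_le_mul_of_nonneg_left hF₇ h3]

end Increments

end Summit.FinalStateConjecture.FinalStateConjecture.Theorems.ChargeKinematics

namespace Summit.FinalStateConjecture.FinalStateConjecture.Theorems

/-- REGISTERED STUB `passage_budget_le` of the crux item stmt-FinalStateConjecture-10166 (second line lead, line
`old-light-leaves-the-cone`, S4 helper series): the registered one-line signature verbatim, discharged by
`ChargeKinematics.passage_budget_le`. [folklore] -/
theorem passage_budget_le : open Literature.Geometry.Lorentzian Filter Topology MeasureTheory intervalIntegral in ∀ {R φ φ' : ℝ → ℝ} {t₀ τ m₀ c₂ g : ℝ} (ht₀ : 0 < t₀) (hτ : t₀ ≤ τ) (hm₀ : 0 < m₀) (hc₂ : 0 < c₂) (hg : 0 < g) (hRcont : ContinuousOn R (Set.Icc t₀ τ)) (hR1 : ∀ s ∈ Set.Icc t₀ τ, 1 ≤ R s) (hRge : ∀ s ∈ Set.Icc t₀ τ, min (max m₀ |φ s| / 3) (c₂ * s) ≤ R s) (hφ : ∀ s, HasDerivAt φ (φ' s)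 s) (hφ' : Continuous φ') (hmono : ∀ s ∈ Set.Icc t₀ τ, g ≤ φ' s), ∫ s in t₀..τ, (((R s) ^ 2)⁻¹ + ((R s) ^ (7 / 4 : ℝ))⁻¹) ≤ 9 * (2 * 2 * m₀ ^ (1 - 2 : ℝ) / ((2 - 1) * g)) + (3 : ℝ) ^ (7 / 4 : ℝ) * (2 * (7 / 4) * m₀ ^ (1 - 7 / 4 : ℝ) / ((7 / 4 - 1) * g)) + ((c₂ ^ 2 * t₀)⁻¹ + 4 / 3 * c₂ ^ (-(7 / 4) : ℝ) * t₀ ^ (-(3 / 4) : ℝ)) :=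
  @ChargeKinematics.passage_budget_le

end Summit.FinalStateConjecture.FinalStateConjecture.Theorems

end
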